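import Summits.CriticalPhenomena.PercolationContinuityZ3.Theorems.PercNearOneGluingNoHeavyLowerTailSunflowerHallGladkovKernel
import Mathlib.LinearAlgebra.Dimension.Constructions
import Mathlib.LinearAlgebra.Dimension.StrongRankCondition
import Mathlib.LinearAlgebra.Matrix.ToLin
import HarnessLib
import HarnessLib.Audit

/-!
# `NoHeavyLowerTail` (crux stmt-CriticalPhenomena-4575), abstract sunflower cubic: HALL–GLADKOV and `IX-gen` ARE THEOREMS;
# ★ (`0 ≤ ZH`) for every sunflower with an intersecting petal

Seat `prim-l12-p2` gen 17 (`--supports stmt-CriticalPhenomena-4575`).  No `sorry`, no new definitions.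
Memo: run/shared/lean/prim/prim-l12/prim-l12-p2/FINDING-g17-HALL-GLADKOV-PROVED.md.

This file discharges the two `@[conjecture]` obligations of `…SunflowerHallGladkov` (gen 15):
* `ixGen_holds : IXGen` — for up-sets `V₁, V₂`, a down-set `D` and a cube `W`, `#(POS ∩ D) ≤ #(NEG ∩ D)`;
* `hallGladkov_holds : HallGladkov` — `POS` injects into `NEG` along containment (the marriage form of Gladkov's two-family inequality);
and hence, through the gen-13/15 chain (`Sunflower.cube_le_of_ixGen`, `two_N140_le_SB_of_ixGen`, `Ntri_le_three_SB_of_ixGen`,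
`ZH_nonneg_of_ixGen_of_intersecting`), UNCONDITIONALLY:
* `Sunflower.cube_le_of_intersecting`, `Sunflower.Ntri_le_three_SB_of_intersecting` (LEMMA B) and
* `Sunflower.ZH_nonneg_of_intersecting` — **the partition lemma ★ (`0 ≤ ZH`, prove-1's `PartitionLemmaH` instance) for every sunflower
  one of whose petals is an INTERSECTING family** (no two disjoint sets of that label); this contains the least-element / centred classes
  of `…SunflowerPrincipalPetal` / `…SunflowerCenteredPetal`.
METHOD (GF(2) rank).  By `HallGladkov.pos_kernel_trivial` (`…SunflowerHallGladkovKernel`, resting on the parity lemma `Ξ² = I` of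
`…SunflowerParityLemma`) the `POS × NEG` containment matrix has full row rank over `GF(2)`; restricted to `POS ∩ D` its rows are supported
on `NEG ∩ D` (`D` is a down-set), so the containment matrix gives an INJECTIVE linear map `(POS ∩ D → 𝔽₂) → (NEG ∩ D → 𝔽₂)` and
`#(POS ∩ D) ≤ #(NEG ∩ D)` is a `finrank` comparison.  `HallGladkov` then follows by Hall's theorem (`hallGladkov_of_ixGen`).
What remains open for ★ in general: sunflowers all of whose petals are NON-intersecting (every petal has two disjoint sets), where
Lemma B fails (doubled star) and the kernel slack `SA` must pay (`…SunflowerCorrectedLemmaB`).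
-/

namespace Summit.CriticalPhenomena.PercolationContinuityZ3.Theorems.SunflowerPartition

open Finset

/-! ## `IXGen` from the kernel lemma: a rank count over `GF(2)` -/

/-- **`IX-gen` HOLDS** (this work): for up-sets `V₁, V₂`, a down-set `D` and a cube `W`, `#(POS ∩ D) ≤ #(NEG ∩ D)`.
Proof: the `GF(2)`-linear map `(POS ∩ D → 𝔽₂) → (NEG ∩ D → 𝔽₂)` given by the containment matrix is injective — a kernel vector,
extended by zero to `POS`, satisfies the hypothesis of `HallGladkov.pos_kernel_trivial` (for `O ∈ NEG ∖ D` no `T ∈ D` contains `O`,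
`D` being a down-set) — and injective linear maps do not increase `finrank`. [this work] -/
theorem ixGen_holds : IXGen := by
  intro α _ V₁ V₂ D W h₁ h₂ hD
  classical
  set P := (HallGladkov.pos V₁ V₂ W).filter (· ∈ D) with hP
  set Nn := (HallGladkov.neg V₁ V₂ W).filter (· ∈ D) with hNn
  let M : Matrix Nn P (ZMod 2) := Matrix.of fun O T => if (O.1 : Finset α) ⊆ T.1 then 1 else 0
  have hinj : Function.Injective (Matrix.mulVecLin M) := by
    rw [← LinearMap.ker_eq_bot, LinearMap.ker_eq_bot']
    intro g hg
    -- extend `g` by zero to all of `POS`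
    let lam : Finset α → ZMod 2 := fun T => if h : T ∈ P then g ⟨T, h⟩ else 0
    have hlamP : ∀ x : P, g x = lam x.1 := fun x => by simp only [lam, dif_pos x.2]
    have hlam0 : ∀ T, T ∉ P → lam T = 0 := fun T hT => by simp only [lam, dif_neg hT]
    have hlam : ∀ O ∈ HallGladkov.neg V₁ V₂ W,
        (∑ T ∈ HallGladkov.pos V₁ V₂ W, (if O ⊆ T then lam T else 0)) = 0 := by
      intro O hO
      -- the sum over `POS` is the sum over `P = POS ∩ D`
      have hsum : (∑ T ∈ HallGladkov.pos V₁ V₂ W, (if O ⊆ T then lam T else 0))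
          = ∑ T ∈ P, (if O ⊆ T then lam T else 0) := by
        rw [hP, Finset.sum_filter]
        refine sum_congr rfl fun T hT => ?_
        by_cases hTD : T ∈ D
        · rw [if_pos hTD]
        · rw [if_neg hTD]
          have hTP : T ∉ P := fun h => hTD (mem_filter.1 h).2
          rw [hlam0 T hTP, ite_self]
      rw [hsum]
      by_cases hOD : O ∈ D
      · have hO' : O ∈ Nn := mem_filter.2 ⟨hO, hOD⟩
        have h0 : (M.mulVec g) ⟨O, hO'⟩ = 0 := by
          have := congrFun (show M.mulVec g = 0 from (Matrix.mulVecLin_apply M g).symm.trans hg) ⟨O, hO'⟩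
          exact this
        simp only [Matrix.mulVec, dotProduct, M, Matrix.of_apply] at h0
        rw [← Finset.sum_coe_sort P]
        refine Eq.trans (sum_congr rfl fun x _ => ?_) h0
        rw [boole_mul, hlamP x]
      · refine sum_eq_zero fun T hT => ?_
        rw [if_neg]
        intro hOT
        exact hOD (hD hOT (mem_filter.1 hT).2)
    have hz := HallGladkov.pos_kernel_trivial h₁ h₂ W lam hlam
    funext x
    rw [hlamP x, Pi.zero_apply]
    exact hz x.1 (mem_filter.1 x.2).1
  have hle := LinearMap.finrank_le_finrank_of_injective hinj
  rw [Module.finrank_fintype_fun_eq_card, Module.finrank_fintype_fun_eq_card, Fintype.card_coe, Fintype.card_coe] at hle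
  exact hle

/-- **HALL–GLADKOV HOLDS** (this work): for up-sets `V₁, V₂` and a cube `W`, the family `POS` admits an injection `φ` into `NEG` with
`φ T ⊆ T` — the marriage form of Gladkov's two-family inequality. [this work] -/
theorem hallGladkov_holds : HallGladkov := hallGladkov_of_ixGen ixGen_holds

/-! ## Consequences for sunflowers: the partition lemma ★ for every sunflower with an intersecting petal -/

section Consequences

variable {α : Type} [Fintype α] [DecidableEq α]

/-- **The cube inequality**, unconditionally: for a sunflower whose petal `0` is an intersecting family, on every cube `W`,
`#{(1,⊤)} + #{(⊤,1)} ≤ Σ_{T ⊆ W} kk (lab T) (lab (W∖T))`. [this work] -/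
theorem Sunflower.cube_le_of_intersecting (F : Sunflower α)
    (hI : ∀ S T : Finset α, F.lab S = 1 → F.lab T = 1 → ¬ Disjoint S T) (W : Finset α) :
    ∑ T ∈ W.powerset, (ind14 (F.lab T) (F.lab (W \ T)) + ind14 (F.lab (W \ T)) (F.lab T))
      ≤ ∑ T ∈ W.powerset, kk (F.lab T) (F.lab (W \ T)) :=
  F.cube_le_of_ixGen ixGen_holds hI W

/-- **LEMMA B**, unconditionally, for a sunflower whose petal `0` is an intersecting family: `Ntri ≤ 3·SB`. [this work] -/
theorem Sunflower.Ntri_le_three_SB_of_intersecting (F : Sunflower α)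
    (hI : ∀ S T : Finset α, F.lab S = 1 → F.lab T = 1 → ¬ Disjoint S T) : F.Ntri ≤ 3 * F.SB :=
  F.Ntri_le_three_SB_of_ixGen ixGen_holds hI

/-- **★ (the partition lemma `0 ≤ ZH`) for EVERY SUNFLOWER WITH AN INTERSECTING PETAL**, unconditionally (this work): if for some petal
`ℓ ∈ {1,2,3}` no two sets of label `ℓ` are disjoint, then `0 ≤ ZH`. [this work] -/
theorem Sunflower.ZH_nonneg_of_intersecting (F : Sunflower α) (ℓ : Fin 5) (hℓ : ℓ = 1 ∨ ℓ = 2 ∨ ℓ = 3)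
    (hI : ∀ S T : Finset α, F.lab S = ℓ → F.lab T = ℓ → ¬ Disjoint S T) : 0 ≤ F.ZH :=
  F.ZH_nonneg_of_ixGen_of_intersecting ixGen_holds ℓ hℓ hI

end Consequences

end Summit.CriticalPhenomena.PercolationContinuityZ3.Theorems.SunflowerPartition
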